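import Summits.Ventures.HodgeRepro2.T6PeriodInput6
import Summits.Ventures.HodgeRepro2.T6N41PlaceKappaMain
import Summits.Ventures.HodgeRepro2.T6N41TauMain
import Summits.Ventures.HodgeRepro2.T6N42HypGQT
import Summits.Ventures.HodgeRepro2.T6N5RichMain
import Summits.Ventures.HodgeRepro2.T6N5RichSH

/-!
# T6PeriodInput7 — the period input `(N)` from the published displays, v7 (Tier 6, M2 candidate; proof lane; lead)

`periodInputN_of_published₇ (M : NAut3 F P)` is the M2 COMPOSITION v7 = the lead's `periodInputN_of_published₆`
(T6PeriodInput6, p407424, commit 6a11500bc12efc0b01d7ce3147be37ae2bab237a; the declared M2 of record, 131 binders)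
with the two owner drop-ins of the v7 PLAN OF RECORD (STATUS l. 11672) merged, the composition proof being v6's
`periodInputN_of_mains₃` body with the N4 and N5 mains re-supplied:

* N4, per side (t6-p4; T6N41PlaceKappaMain / T6N41TauMain / T6N42HypGQT, its staged `T6PeriodInput6PlacedTau`
  taken VERBATIM for the binders and the terms): the class-AD binder `hunr` (the unramified identity
  `L_v = g₁ g₂` off `S`) is replaced by the placement lane's data `Pl In Sp LQ Kd`, its SEVEN displays
  (`LapidRallis2005_Sec7_Unramified`, `Bump1997_5_22`, `HarrisII2007_Prop2_2_5_b`, `Rogawski1990_Sec11_4_BC`,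
  `Minguez2008_Thm1_2_LQ`, `Bump1997_Thm4_5_1`, `Rao1993_CorA5_1`), the dichotomy `hdich` [elementary] and the
  ONE residual `hκ'` [AD, the local convention identity `κ_v(ϖ_v) = κ′(ϖ_v)⁻¹`] — discharged by
  `N41Place.N41_placement_kappa`; the class-IR binder `hτ' : σ ≠ ⊥ → hypI` is replaced by the τ′ layer: the
  pure-tensor test datum `Td : TauDatum`, the displays `GQT2014_Thm11_4_ii_Rallis Td` (GQT Thm 11.4(ii) with
  (11.3)) and `GQT2014_Sec11_6_Unramified Td` (GQT §11.6) and t6-p5's `GQT2014_Prop35_i` at the split and the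
  non-split places — discharged by `TauDatum.hypI_of_rallis` on `NSide.R1AndHloc_of`, `N42Main.N42_zeta_main`
  and `N43Places.archNonvanishing_withLfac`; the display `GQT2014_Thm11_7_ii` (`hR`) stays a binder.
* N5 (t6-p7; T6N5RichMain / T6N5RichSH, its staged `T6PeriodInput6N5Rich` taken VERBATIM): the binders
  `hL5 ha5 hb5` are replaced by the rich datum `R5 : N5Rich.RichData` with `hR5 : M.d5 = R5.toN5Data` [EX], the
  construction facts `hL` [EX], the (S–H) dictionary `dict / hA / hB` [EX] closed through the N2 main
  `N2ToyIso.N2_main_explicit` the composition already consumes, the local solutions `hsol` [EX] and the real-place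
  condition `hre` [IR]; the N5 main is `N5RichMain.N5_of_rich` with `N5RichSH.SH_of_admDatum`.

Every other binder is v6's VERBATIM (same names, same order). Census relative to v6 (131 named binders): 131 →
170 (per side: −2 (`hunr`, `hτ'`) + 14 (placement: `Pl In Sp LQ Kd`, seven displays, `hdich`, `hκ'`) + 5 (τ′
layer: `Td`, two displays, `hZs`, `hZn`) = +17, both sides +34; N5: −3 (`hL5 ha5 hb5`) + 8 (`R5 hR5 hL dict hA hB
hsol hre`) = +5; the N5 display `hT` and `hc5` verbatim); residual classes: N4 AD «6 × 2» → «5 × 2 (`hIS hpos hnm hFL hκ'`)», N4 IR `hτ'` ×2 → 0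
(+3 compat fields inside the placement data per side: `InertDatum.BCχ_eq`, `SplitDatum.BCχ_p₁/p₂`), N5 IR 3 → 1
(`hre`); displays by name +11 per side (7 placement, 2 τ′, 2 `GQT2014_Prop35_i`), N5 unchanged. The §10.5(ii)(d)
witness of v7 (t6-p6, on the joint toy `toy2 D σ₀` of T6PeriodInput6Toy2 p409931) is OPEN — the placement chain
over t6-p5's `toyD41` is not yet a theorem (STATUS l. 11830 (3)); until it lands, v6 remains the declared M2 of
record and this file is a composition object only (ruling STATUS l. 11672).

§8(d): uses an L-value-free non-vanishing device: NO.
-/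

namespace Summit.Ventures.HodgeRepro2.T6

open N5Skeleton
open scoped InnerProductSpace

variable {K : Type*} [Field K] [NumberField K] [NumberField.IsCMField K] {F : FaceSetting K}
  {P : NDatum F}

/-- THE PERIOD INPUT `(N)` FROM THE PUBLISHED DISPLAYS, v7: `periodInputN_of_published₆` with, per side, `hunr`
replaced by the placement lane (data, seven displays, `hdich`, the residual `hκ'`; `N41Place.N41_placement_kappa`)
and `hτ'` by the τ′ layer (`TauDatum.hypI_of_rallis`), and the N5 block on the rich datum (`N5RichMain.N5_of_rich`,
`N5RichSH.SH_of_admDatum`); every other binder verbatim; the proof is v6's `periodInputN_of_mains₃` body. -/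
theorem periodInputN_of_published₇ (M : NAut3 F P)
    -- v2: every quadruple of Schwartz data is the data of some choice (EX, by construction on the host)
    (hex : ∀ (φa : M.d3.A.Sa) (φb : M.d3.A.Sb) (φc : M.d3.B.Sa) (φd : M.d3.B.Sb),
      ∃ c, M.data c = (φa, φb, φc, φd))
    -- N2 (t6-p5): the datum's explicit shape [EX ×4, no display], for `N2_main_explicit`
    (hfr : T5CubeTypes.IsCMFrame M.d2.τ)
    (h₁₁₁ : IsLiuSignElement K (M.d2.type T5DatumSimilitude.t111) M.d2.e₁₁₁)
    (hm : N2ToyIso.MagSpec M.d2.τ M.d2.u) (he : M.d2.e₁₀₀ = M.d2.u * (1 - M.d2.u) * M.d2.e₁₁₁)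
    -- N3iso (t6-p3): the binders of `N3iso_main₂` — the sentence N2 and N3 share [AD], Rogawski 1990
    -- §14.6 / 14.6.4 / 14.6.5 on the packet carrier `R` [displays], the Π_s residual [AD], the dictionary
    -- `hRbr` [AD] and the N3.L8 interface Props [AD]
    (hAdm : M.d2.AdmGenerating) (R : RogawskiPackets)
    (hR0 : Hyp.Rogawski1990_Sec14_6_Partition R) (hR1 : Hyp.Rogawski1990_Thm14_6_4 R)
    (hR2 : Hyp.Rogawski1990_Thm14_6_5 R) (hs : ∀ P' ∈ R.Ps, ∀ π, R.mem π P' → R.m π ≤ 1)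
    (hst : M.d3.AutStable) (hRbr : M.d3.RogawskiBridge R hst) (hO : M.d3.AutOrthogonal)
    (hsimp : M.d3.AutSimple) (hPX : M.d3.ProductsIn20 M.d3.A)
    (hPeqX : M.d3.ProductEquivariant M.d3.A) (hPY : M.d3.ProductsIn20 M.d3.B)
    (hPeqY : M.d3.ProductEquivariant M.d3.B) (hσX : M.d3.SigmaIsAut M.d3.A)
    (hσ : M.d3.B.σ = M.d3.A.σ)
    -- N1 (t6-p1): the four displays of T6N1Hyp on the carrier's N1 datum
    (hN1H : Hyp.Voisin2002_7_3_2 M.d1) (hN1L : Hyp.Voisin2002_Lemma5_4_petersson M.d1)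
    (hN1A : Hyp.Liu2021_Prop4_13_vertexLiftA M.d1) (hN1B : Hyp.Liu2021_Prop4_13_vertexLiftB M.d1)
    -- N3A (t6-p3): Gan–Takeda at the non-archimedean places + the class-AD interface Props, side A
    {ιA : Type} (LA : ιA → HoweDualityShape) (hHDA : ∀ v, Hyp.GanTakeda2016_Thm1_2 (LA v))
    (hHDbrA : M.d3.HoweDualityBridge LA M.d3.A) (hKCA : M.d3.A.KliftCont)
    (hSeamA : M.d3.A.Seam hKCA) (hAdjA : M.d3.A.Adjoint) (hKLA : M.d3.A.KliftLevel)
    (hΘτA : M.d3.A.ThetaTauType M.d3.τiso) (hEA : M.d3.A.CopiesEquivariant)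
    (hOA : M.d3.A.CopiesOrthogonal) (hInclA : M.d3.A.CopiesIncl) (hTauA : M.d3.A.CopiesTauType)
    (hDecA : M.d3.A.TauTypeDecomposes) (hFA : M.d3.A.LevelPartFinite) (hCA : M.d3.A.LevelPartCont)
    (hAvgA : M.d3.A.KAverage) (hEqA : M.d3.A.ThetaEquivariant) (hSpanA : M.d3.A.SpanOfFixedVector)
    (hCOA : M.d3.A.CrossCopyOrthogonal) (hIndA : M.d3.A.CopyIndependence) (hTSA : M.d3.A.TensorsSpan)
    -- N3B (t6-p3): the same on side B
    {ιB : Type} (LB : ιB → HoweDualityShape) (hHDB : ∀ v, Hyp.GanTakeda2016_Thm1_2 (LB v))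
    (hHDbrB : M.d3.HoweDualityBridge LB M.d3.B) (hKCB : M.d3.B.KliftCont)
    (hSeamB : M.d3.B.Seam hKCB) (hAdjB : M.d3.B.Adjoint) (hKLB : M.d3.B.KliftLevel)
    (hΘτB : M.d3.B.ThetaTauType M.d3.τiso) (hEB : M.d3.B.CopiesEquivariant)
    (hOB : M.d3.B.CopiesOrthogonal) (hInclB : M.d3.B.CopiesIncl) (hTauB : M.d3.B.CopiesTauType)
    (hDecB : M.d3.B.TauTypeDecomposes) (hFB : M.d3.B.LevelPartFinite) (hCB : M.d3.B.LevelPartCont)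
    (hAvgB : M.d3.B.KAverage) (hEqB : M.d3.B.ThetaEquivariant) (hSpanB : M.d3.B.SpanOfFixedVector)
    (hCOB : M.d3.B.CrossCopyOrthogonal) (hIndB : M.d3.B.CopyIndependence) (hTSB : M.d3.B.TensorsSpan)
    -- N4 (t6-p4): the binders of `N4_main`, verbatim, except the six (I-P2) binders, which come from
    -- the Bergman-explicit bundles `XA` / `XB` (t6-p6, T6N43BergmanPlaces) through `hxA` / `hxB` [EX]
    -- — at v5 the four (I-P2′) binders `hP2'₂ hP2'₃` per side are discharged the same way
    (XA XB : N43Places.BergmanPlaces) (hxA : M.sA.d43 = XA.toPlaces) (hxB : M.sB.d43 = XB.toPlaces)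
    (hISA : M.sA.d42.IrreducibleSmooth) (hposA : ∀ v, 0 < (M.sA.d42.splitDatum v).n)
    (hnmA : M.sA.d42.TypeIISizes) (hFLA : M.sA.d42.FirstLift)
    (hMA : ∀ v, Hyp.Minguez2008_Theoreme1_2 (M.sA.d42.splitDatum v))
    (hGIA : ∀ v, Hyp.GanIchino2014_Prop5_3_i (M.sA.d42.towerDatum v))
    (hEL₁A : Hyp.EischenLiu2024_Sec2_2 2 0 M.sA.d43.τ₁ M.sA.d43.ν₁ M.sA.d43.r₁ (M.sA.d41.Lv (Sum.inr 0)))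
    (hA2f₂A : Hyp.Ruhl1970_A2f M.sA.d43.d₂)
    (hEL₂A : Hyp.EischenLiu2024_Sec2_2 1 1 M.sA.d43.τ₂ M.sA.d43.ν₂ M.sA.d43.r₂ (M.sA.d41.Lv (Sum.inr 1)))
    (hA2f₃A : Hyp.Ruhl1970_A2f M.sA.d43.d₃)
    (hEL₃A : Hyp.EischenLiu2024_Sec2_2 1 1 M.sA.d43.τ₃ M.sA.d43.ν₃ M.sA.d43.r₃ (M.sA.d41.Lv (Sum.inr 2)))
    (hB₁A : Hyp.GQT2014_Conj11_5_obvious (M.sA.d43.withLfac fun j => M.sA.d41.Lv (Sum.inr j)).d₁ M.sA.d41 (Sum.inr 0))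
    (hB₂A : Hyp.GQT2014_Conj11_5_obvious (M.sA.d43.withLfac fun j => M.sA.d41.Lv (Sum.inr j)).d₂ M.sA.d41 (Sum.inr 1))
    (hB₃A : Hyp.GQT2014_Conj11_5_obvious (M.sA.d43.withLfac fun j => M.sA.d41.Lv (Sum.inr j)).d₃ M.sA.d41 (Sum.inr 2))
    (hGQTA : Hyp.GQT2014_Thm11_4_ii M.sA.d41) (hLRA : Hyp.LapidRallis2005_Sec10_GlobalL M.sA.d41)
    (hpadicA : Hyp.LapidRallis2005_Sec10_padic M.sA.d41 M.sA.archSet)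
    (hI₁eA : Hyp.Iwasawa2019_Sec3_1_EulerProductE M.sA.d41.L₁ M.sA.d41.g₁)
    (hI₂eA : Hyp.Iwasawa2019_Sec3_1_EulerProductE M.sA.d41.L₂ M.sA.d41.g₂)
    (hI₁A : Hyp.Iwasawa2019_Thm3_1 M.sA.d41.L₁ M.sA.d41.triv₁)
    (hI₂A : Hyp.Iwasawa2019_Thm3_1 M.sA.d41.L₂ M.sA.d41.triv₂)
    (hP₁A : Hyp.Iwasawa2019_Prop4_4 M.sA.d41.L₁ M.sA.d41.triv₁)
    (hP₂A : Hyp.Iwasawa2019_Prop4_4 M.sA.d41.L₂ M.sA.d41.triv₂)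
    -- the placement (P7) on side A (t6-p4, T6N41Place* + the (A″κ) layer T6N41PlaceKappa*): the data, SEVEN displays,
    -- the dichotomy [elementary], and the ONE residual `hκ'` [AD: TIER5 §N4.1.10 Lemma A′-4 (b4)–(b6), the local
    -- convention identity `κ_v(ϖ_v) = κ′(ϖ_v)⁻¹`] — in place of v6's `hunrA` (N4-PLACED-DROPIN.md option 1)
    (PlA : PlacementDatum M.sA.d41) (InA : InertDatum PlA) (SpA : SplitDatum InA) (LQA : SplitLQ SpA)
    (KdA : KappaDatum SpA)
    (hLR7A : Hyp.LapidRallis2005_Sec7_Unramified M.sA.d41 PlA) (hBumpA : Hyp.Bump1997_5_22 PlA)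
    (hHaA : Hyp.HarrisII2007_Prop2_2_5_b InA) (hRoA : Hyp.Rogawski1990_Sec11_4_BC InA)
    (hMinA : Hyp.Minguez2008_Thm1_2_LQ LQA) (hB451A : Hyp.Bump1997_Thm4_5_1 LQA)
    (hRaoA : Hyp.Rao1993_CorA5_1 KdA)
    (hdichA : ∀ 𝔓, PlA.b 𝔓 ∉ M.sA.d41.S → InA.inert 𝔓 ∨ SpA.splitPlace (PlA.b 𝔓))
    (hκ'A : ∀ v, SpA.splitPlace v → v ∉ M.sA.d41.S → KdA.κv v = (KdA.κ' v)⁻¹)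
    (hRA : Hyp.GQT2014_Thm11_7_ii M.d3.A M.sA.d41)
    -- the τ′ layer on side A (t6-p4, T6N41Tau*): the pure-tensor test datum, the two GQT displays and t6-p5's
    -- `GQT2014_Prop35_i` at the split / non-split places — in place of v6's `hτ'A` [IR], now DISCHARGED
    (TdA : TauDatum M.d3.A M.sA) (hRIPA : Hyp.GQT2014_Thm11_4_ii_Rallis TdA)
    (hU116A : Hyp.GQT2014_Sec11_6_Unramified TdA)
    (hZsA : ∀ v, Hyp.GQT2014_Prop35_i (M.sA.d42.splitDatum v).pair (M.sA.d42.zetaSplit v))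
    (hZnA : ∀ v, Hyp.GQT2014_Prop35_i ((M.sA.d42.towerDatum v).pair 1) (M.sA.d42.zetaNonsplit v))
    (hISB : M.sB.d42.IrreducibleSmooth) (hposB : ∀ v, 0 < (M.sB.d42.splitDatum v).n)
    (hnmB : M.sB.d42.TypeIISizes) (hFLB : M.sB.d42.FirstLift)
    (hMB : ∀ v, Hyp.Minguez2008_Theoreme1_2 (M.sB.d42.splitDatum v))
    (hGIB : ∀ v, Hyp.GanIchino2014_Prop5_3_i (M.sB.d42.towerDatum v))
    (hEL₁B : Hyp.EischenLiu2024_Sec2_2 2 0 M.sB.d43.τ₁ M.sB.d43.ν₁ M.sB.d43.r₁ (M.sB.d41.Lv (Sum.inr 0)))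
    (hA2f₂B : Hyp.Ruhl1970_A2f M.sB.d43.d₂)
    (hEL₂B : Hyp.EischenLiu2024_Sec2_2 1 1 M.sB.d43.τ₂ M.sB.d43.ν₂ M.sB.d43.r₂ (M.sB.d41.Lv (Sum.inr 1)))
    (hA2f₃B : Hyp.Ruhl1970_A2f M.sB.d43.d₃)
    (hEL₃B : Hyp.EischenLiu2024_Sec2_2 1 1 M.sB.d43.τ₃ M.sB.d43.ν₃ M.sB.d43.r₃ (M.sB.d41.Lv (Sum.inr 2)))
    (hB₁B : Hyp.GQT2014_Conj11_5_obvious (M.sB.d43.withLfac fun j => M.sB.d41.Lv (Sum.inr j)).d₁ M.sB.d41 (Sum.inr 0))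
    (hB₂B : Hyp.GQT2014_Conj11_5_obvious (M.sB.d43.withLfac fun j => M.sB.d41.Lv (Sum.inr j)).d₂ M.sB.d41 (Sum.inr 1))
    (hB₃B : Hyp.GQT2014_Conj11_5_obvious (M.sB.d43.withLfac fun j => M.sB.d41.Lv (Sum.inr j)).d₃ M.sB.d41 (Sum.inr 2))
    (hGQTB : Hyp.GQT2014_Thm11_4_ii M.sB.d41) (hLRB : Hyp.LapidRallis2005_Sec10_GlobalL M.sB.d41)
    (hpadicB : Hyp.LapidRallis2005_Sec10_padic M.sB.d41 M.sB.archSet)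
    (hI₁eB : Hyp.Iwasawa2019_Sec3_1_EulerProductE M.sB.d41.L₁ M.sB.d41.g₁)
    (hI₂eB : Hyp.Iwasawa2019_Sec3_1_EulerProductE M.sB.d41.L₂ M.sB.d41.g₂)
    (hI₁B : Hyp.Iwasawa2019_Thm3_1 M.sB.d41.L₁ M.sB.d41.triv₁)
    (hI₂B : Hyp.Iwasawa2019_Thm3_1 M.sB.d41.L₂ M.sB.d41.triv₂)
    (hP₁B : Hyp.Iwasawa2019_Prop4_4 M.sB.d41.L₁ M.sB.d41.triv₁)
    (hP₂B : Hyp.Iwasawa2019_Prop4_4 M.sB.d41.L₂ M.sB.d41.triv₂)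
    -- the placement (P7) on side B (t6-p4, T6N41Place* + the (A″κ) layer T6N41PlaceKappa*): the data, SEVEN displays,
    -- the dichotomy [elementary], and the ONE residual `hκ'` [AD: TIER5 §N4.1.10 Lemma A′-4 (b4)–(b6), the local
    -- convention identity `κ_v(ϖ_v) = κ′(ϖ_v)⁻¹`] — in place of v6's `hunrB` (N4-PLACED-DROPIN.md option 1)
    (PlB : PlacementDatum M.sB.d41) (InB : InertDatum PlB) (SpB : SplitDatum InB) (LQB : SplitLQ SpB)
    (KdB : KappaDatum SpB)
    (hLR7B : Hyp.LapidRallis2005_Sec7_Unramified M.sB.d41 PlB) (hBumpB : Hyp.Bump1997_5_22 PlB)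
    (hHaB : Hyp.HarrisII2007_Prop2_2_5_b InB) (hRoB : Hyp.Rogawski1990_Sec11_4_BC InB)
    (hMinB : Hyp.Minguez2008_Thm1_2_LQ LQB) (hB451B : Hyp.Bump1997_Thm4_5_1 LQB)
    (hRaoB : Hyp.Rao1993_CorA5_1 KdB)
    (hdichB : ∀ 𝔓, PlB.b 𝔓 ∉ M.sB.d41.S → InB.inert 𝔓 ∨ SpB.splitPlace (PlB.b 𝔓))
    (hκ'B : ∀ v, SpB.splitPlace v → v ∉ M.sB.d41.S → KdB.κv v = (KdB.κ' v)⁻¹)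
    (hRB : Hyp.GQT2014_Thm11_7_ii M.d3.B M.sB.d41)
    -- the τ′ layer on side B (t6-p4, T6N41Tau*): the pure-tensor test datum, the two GQT displays and t6-p5's
    -- `GQT2014_Prop35_i` at the split / non-split places — in place of v6's `hτ'B` [IR], now DISCHARGED
    (TdB : TauDatum M.d3.B M.sB) (hRIPB : Hyp.GQT2014_Thm11_4_ii_Rallis TdB)
    (hU116B : Hyp.GQT2014_Sec11_6_Unramified TdB)
    (hZsB : ∀ v, Hyp.GQT2014_Prop35_i (M.sB.d42.splitDatum v).pair (M.sB.d42.zetaSplit v))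
    (hZnB : ∀ v, Hyp.GQT2014_Prop35_i ((M.sB.d42.towerDatum v).pair 1) (M.sB.d42.zetaNonsplit v))
    -- N5 (t6-p7, RE-CUT ON THE RICH DATUM — T6N5Rich / T6N5RichMain / T6N5RichSH): Theorem 5.6 on the datum's two
    -- sides [PO]; the rich datum `R5` with `hR5` [EX, by construction]; the construction facts `hL` [EX — N5.L1 ×2
    -- a theorem]; (S–H) through N2's `M.AdmDatum` via `dict` / `hA` / `hB` [EX — (a) ×2 a theorem]; the local
    -- solutions `hsol` [EX, witnessed per place by t6-p8 — (b) at the finite places a theorem]; (b) at the real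
    -- places `hre` [IR here; display-level discharge in T6N5RealPlace + T6N5FockMain]; (c) `hc5` [EX]
    (hT : Hyp.BFGYYZ2025_Thm5_6 ({M.d5.A, M.d5.B} : Set (ToricSide M.ι5 M.G5)))
    (R5 : N5Rich.RichData M.ι5 M.G5) (hR5 : M.d5 = R5.toN5Data) (hL : R5.LevelHyps)
    (dict : M.d2.Char →* M.G5) (hA : R5.rA = dict (M.d2.χ₁₁₁ * M.d2.χ₁₀₀))
    (hB : R5.rB = dict (M.d2.χ₁₀₁ * M.d2.χ₁₁₀)) (hsol : R5.S.Solves) (hre : R5.S.RealCondB)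
    (hc5 : M.d5.condC) :
    ∃ c, P.AdmChoice c ∧ Hyp.PeriodN (P.shadow c) :=
  periodInputN_of_mains₃ P M
    (N1Main.N1_main M.d1 hN1H hN1L hN1A hN1B)
    (N2ToyIso.N2_main_explicit (M.toNAut2' hex) hfr h₁₁₁ hm he)
    (N3Main.N3A_main (M.toNAut' hex) LA hHDA hHDbrA hKCA hSeamA hAdjA hKLA hΘτA hEA hOA hInclA hTauA hDecA hFA hCA hAvgA hEqA hSpanA hCOA hIndA hTSA)
    (N3Main.N3B_main (M.toNAut' hex) LB hHDB hHDbrB hKCB hSeamB hAdjB hKLB hΘτB hEB hOB hInclB hTauB hDecB hFB hCB hAvgB hEqB hSpanB hCOB hIndB hTSB)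
    (N3Main.N3iso_main₂ (M.toNAut2' hex) hAdm R hR0 hR1 hR2 hs hst hRbr hO hsimp hPX hPeqX hPY hPeqY hσX hσ)
    (N4_main (M.toNAut' hex)
      hISA hposA hnmA hFLA hMA hGIA (XA.characterCoefficient_of_eq _ hxA) hEL₁A
      (XA.fockLineIdentification₂_of_eq _ hxA) (XA.lowestWeightCoefficient₂_of_eq _ hxA) hA2f₂A hEL₂A
      (XA.fockLineIdentification₃_of_eq _ hxA) (XA.lowestWeightCoefficient₃_of_eq _ hxA) hA2f₃A
      hEL₃A hB₁A hB₂A hB₃A hGQTA hLRA hpadicA hI₁eA hI₂eA hI₁A hI₂A hP₁A hP₂A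
      (N41Place.N41_placement_kappa M.sA.d41 PlA InA SpA LQA KdA hLR7A hBumpA hHaA hRoA hMinA hB451A hRaoA hdichA hκ'A)
      hRA
      (fun _ => TdA.hypI_of_rallis hRIPA hU116A
        (M.sA.R1AndHloc_of hISA hposA hnmA hFLA hMA hGIA (XA.characterCoefficient_of_eq _ hxA) hEL₁A
          (XA.fockLineIdentification₂_of_eq _ hxA) (XA.lowestWeightCoefficient₂_of_eq _ hxA) hA2f₂A hEL₂A
          (XA.fockLineIdentification₃_of_eq _ hxA) (XA.lowestWeightCoefficient₃_of_eq _ hxA) hA2f₃A hEL₃A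
          hB₁A hB₂A hB₃A hGQTA hLRA hpadicA hI₁eA hI₂eA hI₁A hI₂A hP₁A hP₂A
          (N41Place.N41_placement_kappa M.sA.d41 PlA InA SpA LQA KdA hLR7A hBumpA hHaA hRoA hMinA hB451A
            hRaoA hdichA hκ'A))
        (N42Main.N42_zeta_main M.sA.d42 hISA hposA hnmA hFLA hMA hGIA hZsA hZnA)
        (N43Places.archNonvanishing_withLfac M.sA.d43 _ (XA.characterCoefficient_of_eq _ hxA) hEL₁A
          (XA.fockLineIdentification₂_of_eq _ hxA) (XA.lowestWeightCoefficient₂_of_eq _ hxA) hA2f₂A hEL₂A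
          (XA.fockLineIdentification₃_of_eq _ hxA) (XA.lowestWeightCoefficient₃_of_eq _ hxA) hA2f₃A hEL₃A))
      hISB hposB hnmB hFLB hMB hGIB (XB.characterCoefficient_of_eq _ hxB) hEL₁B
      (XB.fockLineIdentification₂_of_eq _ hxB) (XB.lowestWeightCoefficient₂_of_eq _ hxB) hA2f₂B hEL₂B
      (XB.fockLineIdentification₃_of_eq _ hxB) (XB.lowestWeightCoefficient₃_of_eq _ hxB) hA2f₃B
      hEL₃B hB₁B hB₂B hB₃B hGQTB hLRB hpadicB hI₁eB hI₂eB hI₁B hI₂B hP₁B hP₂B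
      (N41Place.N41_placement_kappa M.sB.d41 PlB InB SpB LQB KdB hLR7B hBumpB hHaB hRoB hMinB hB451B hRaoB hdichB hκ'B)
      hRB
      (fun _ => TdB.hypI_of_rallis hRIPB hU116B
        (M.sB.R1AndHloc_of hISB hposB hnmB hFLB hMB hGIB (XB.characterCoefficient_of_eq _ hxB) hEL₁B
          (XB.fockLineIdentification₂_of_eq _ hxB) (XB.lowestWeightCoefficient₂_of_eq _ hxB) hA2f₂B hEL₂B
          (XB.fockLineIdentification₃_of_eq _ hxB) (XB.lowestWeightCoefficient₃_of_eq _ hxB) hA2f₃B hEL₃B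
          hB₁B hB₂B hB₃B hGQTB hLRB hpadicB hI₁eB hI₂eB hI₁B hI₂B hP₁B hP₂B
          (N41Place.N41_placement_kappa M.sB.d41 PlB InB SpB LQB KdB hLR7B hBumpB hHaB hRoB hMinB hB451B
            hRaoB hdichB hκ'B))
        (N42Main.N42_zeta_main M.sB.d42 hISB hposB hnmB hFLB hMB hGIB hZsB hZnB)
        (N43Places.archNonvanishing_withLfac M.sB.d43 _ (XB.characterCoefficient_of_eq _ hxB) hEL₁B
          (XB.fockLineIdentification₂_of_eq _ hxB) (XB.lowestWeightCoefficient₂_of_eq _ hxB) hA2f₂B hEL₂B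
          (XB.fockLineIdentification₃_of_eq _ hxB) (XB.lowestWeightCoefficient₃_of_eq _ hxB) hA2f₃B hEL₃B)))
    (N5RichMain.N5_of_rich M hT R5 hR5 hL
      (N5RichSH.SH_of_admDatum M R5 dict hA hB (N2ToyIso.N2_main_explicit (M.toNAut2' hex) hfr h₁₁₁ hm he))
      hsol hre hc5)

end Summit.Ventures.HodgeRepro2.T6
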